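import Summits.BirchSwinnertonDyer.BirchSwinnertonDyer.Theorems.ResidualThetaTransportAtTwoResidualSignedLambdaLowerCMAtTwoColemanPlusOntoTwoCoeff
import Summits.BirchSwinnertonDyer.BirchSwinnertonDyer.Theorems.ThetaPartnerAtTwoSignedKatoUpToAtTwoLocalTwoColemanKernelConverse
import Summits.BirchSwinnertonDyer.BirchSwinnertonDyer.Theorems.ThetaPartnerAtTwoSignedControlAtTwoPlusLocalInjOfHonda
import Summits.BirchSwinnertonDyer.BirchSwinnertonDyer.Theorems.ResidualThetaTransportAtTwoResidualSignedLambdaLowerCMAtTwoPairingSumPlusValueCoeff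
import HarnessLib

/-!
# `Ker(Col⁺ ⊗ 𝒪) = ann(E⁺_∞)` at `p = 2` (functional model): an `𝒪`-valued functional on `E(ℚ_{2,∞}·ℚ_v)` has plus Coleman value `0`
# iff it kills every `E⁺(ℚ_{2,n}·ℚ_v)` — the KERNEL half of `stub_plusColemanO` with coefficients, by coordinates in a `ℤ₂`-basis of `𝒪`

Route `ResidualThetaTransportAtTwo` (RTT), crux RSL_g `ResidualSignedLambdaLowerCMAtTwo` (stmt-BirchSwinnertonDyer-22608): DAG node N1 ⊗ 𝒪
(STUB-PLAN rev 4 §3.2 `stub_plusColemanO`: kernel = «limit-local-Tate annihilator of ⨆_m (Θ-transported E⁺)ⁿ»; here in Sprung's functional model).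
Seat `prover-bsd-wall-rtt-p2` g15 (`--supports`, closes nothing). Sequel of `…ColemanPlusOntoTwoCoeff` (onto ⊗ 𝒪), `…PairingSumPlusValueCoeff`
(existence ⊗ 𝒪), and of TP2's `SignedKatoOffTwo.LocalTwo` / `.ColemanConverse` files (`Ker Col♭ = ann(E⁺)` over `ℤ₂`). THEOREMS ONLY; BSD is not
proved by any of this.

## What
* §1 Coordinates of `𝒪⟦T⟧` in a `ℤ_p`-basis `b` of `𝒪` (`𝒪` finite free over `ℤ_p`): the `i`-th coordinate series
  `G⁽ⁱ⁾ := mk (k ↦ b.repr (G_k) i) ∈ ℤ_p⟦T⟧` is additive, `ℤ[T]`-LINEAR (`(P·G)⁽ⁱ⁾ = P·G⁽ⁱ⁾` for `P ∈ ℤ[T]`), so divisibility by an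
  integer polynomial descends to coordinates; the coordinate of an orbit polynomial `Σ_j C(z x_j)(X+1)^j` is the orbit polynomial of the
  coordinate functional `z⁽ⁱ⁾ = b.coord i ∘ z`.
* §2 (any `K, p, κ, E, ι, W`, any (L)(TR)-family `d`, `g` with `gʲ·d_m` in the tower) **`eq_zero_of_plusCongr_of_forall_signedPlus`**: if
  `L ∈ 𝒪⟦T⟧` satisfies the even-level congruences `ω_{2m} ∣ Σ_j C(z(gʲ·d_{2m}))(X+1)^j + (−1)^m ω⁻_{2m}·L` for an `𝒪`-valued functional `z` that
  VANISHES on every `E⁺(K_n·K_v)`, then `L = 0` (each coordinate `L⁽ⁱ⁾` vanishes at `ζ − 1` for every `ζ` of exact order `p^{2k}`, `k ≥ 1`: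
  TP2's `hasSum_coeff_zero_of_cyclotomicOmega_dvd_toIwasawa_mul` + `eq_zero_of_forall_even_hasSum_zero`). No (GEN) clause needed.
* §3 (`p = 2`, cyclotomic tower at `v ∋ 2`, HONDA⁺@2 (GEN)(GEN₀)) **`forall_signedPlus_eq_zero_of_plusCongr_zero_two`**: conversely, if the
  congruences hold with `L = 0`, then `z` kills every `E⁺(ℚ_{2,n}·ℚ_v)` (coordinates lie in `Ker Col♭`, then TP2's
  `colemanKer_flat_apply_eq_zero_of_mem_signedLocalPointsOfEmb_one_of_honda`); and the package **`colemanPlus_coeff_two`**: ONE pair `(g, d)` with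
  (L)(TR)(ND)(GEN)(GEN₀) for which, for every `𝒪` finite free over `ℤ₂`, the plus value of every `𝒪`-valued functional exists, every `F ∈ 𝒪⟦T⟧`
  is a value, and value `0` ⟺ vanishing on `⋃_n E⁺(ℚ_{2,n}·ℚ_v)` — i.e. `Col⁺ ⊗ 𝒪 : Hom(E(ℚ_{2,∞}·ℚ_v), 𝒪)/ann(E⁺_∞) ≅ Λ_𝒪`.

References: [Kobayashi2003] Thm. 6.2, Prop. 8.12, 8.18–8.23; [Sprung2012] Thm. 2.2 (2′), Def. 5.9, 7.9; [Sprung2017] Cor. 4.4; [Pollack2003] Lemma 4.7.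
-/

set_option autoImplicit false
-- the Theorems namespace of this sub repeats the summit name by design (D-0017 nested layout)
set_option linter.dupNamespace false

noncomputable section

open scoped Classical
open Polynomial Finset

namespace Summit.BirchSwinnertonDyer.BirchSwinnertonDyer.Theorems.SignedColemanImage

open Literature.NumberTheory.EllipticCurves Literature.NumberTheory.EllipticCurves.Sprung2017
  Literature.NumberTheory.EllipticCurves.Kobayashi2003 Summit.BirchSwinnertonDyer.Rank1Residual.Supersingular

universe u

/-! ## §1 Coordinates of `𝒪⟦T⟧` in a `ℤ_p`-basis of `𝒪` -/

section Coord

variable {p : ℕ} [Fact p.Prime] {O : Type*} [CommRing O] [Algebra ℤ_[p] O] {ι' : Type*} (b : Module.Basis ι' ℤ_[p] O) (i : ι')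

/-- `b.repr ((m : 𝒪) * x) i = m * b.repr x i` for an integer `m` (`ℤ_p`-linearity). [folklore] -/
theorem repr_intCast_mul (m : ℤ) (x : O) : b.repr ((m : O) * x) i = (m : ℤ_[p]) * b.repr x i := by
  rw [← zsmul_eq_mul, map_zsmul, Finsupp.smul_apply, zsmul_eq_mul]

/-- **Coordinates are `ℤ[T]`-linear**: the `i`-th coordinate series of `P·G` (`P ∈ ℤ[T]`, `G ∈ 𝒪⟦T⟧`) is `P` times that of `G`. [folklore] -/
theorem coordSeries_intPoly_mul (P : ℤ[X]) (G : PowerSeries O) :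
    (PowerSeries.mk fun k ↦ b.repr (PowerSeries.coeff k (((P.map (Int.castRingHom O) : O[X]) : PowerSeries O) * G)) i) =
      ((P.map (Int.castRingHom ℤ_[p]) : ℤ_[p][X]) : PowerSeries ℤ_[p]) *
        PowerSeries.mk fun k ↦ b.repr (PowerSeries.coeff k G) i := by
  ext n
  rw [PowerSeries.coeff_mk, PowerSeries.coeff_mul, PowerSeries.coeff_mul, map_sum, Finsupp.coe_finsetSum, Finset.sum_apply]
  refine Finset.sum_congr rfl fun kl _ ↦ ?_
  rw [Polynomial.coeff_coe, Polynomial.coeff_map, eq_intCast, repr_intCast_mul, Polynomial.coeff_coe, Polynomial.coeff_map,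
    eq_intCast, PowerSeries.coeff_mk]

/-- Coordinates are additive. [folklore] -/
theorem coordSeries_add (G H : PowerSeries O) :
    (PowerSeries.mk fun k ↦ b.repr (PowerSeries.coeff k (G + H)) i) =
      (PowerSeries.mk fun k ↦ b.repr (PowerSeries.coeff k G) i) + PowerSeries.mk fun k ↦ b.repr (PowerSeries.coeff k H) i := by
  ext n; simp only [PowerSeries.coeff_mk, map_add, Finsupp.add_apply]

/-- **Divisibility by an integer polynomial descends to coordinates.** [folklore] -/
theorem intPoly_dvd_coordSeries_of_dvd (P : ℤ[X]) {G : PowerSeries O}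
    (h : (((P.map (Int.castRingHom O) : O[X]) : PowerSeries O)) ∣ G) :
    ((P.map (Int.castRingHom ℤ_[p]) : ℤ_[p][X]) : PowerSeries ℤ_[p]) ∣ PowerSeries.mk fun k ↦ b.repr (PowerSeries.coeff k G) i := by
  obtain ⟨H, rfl⟩ := h
  exact ⟨_, coordSeries_intPoly_mul b i P H⟩

/-- **The coordinate of an orbit polynomial is the orbit polynomial of the coordinate functional**:
`(Σ_{j<N} C(c_j)(X+1)^j)⁽ⁱ⁾ = Σ_{j<N} C(b.repr(c_j)_i)(X+1)^j`. [folklore] -/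
theorem coordSeries_orbitSum (N : ℕ) (c : ℕ → O) :
    (PowerSeries.mk fun k ↦ b.repr (PowerSeries.coeff k ((∑ j ∈ range N, C (c j) * (X + 1) ^ j : O[X]) : PowerSeries O)) i) =
      ((∑ j ∈ range N, C (b.repr (c j) i) * (X + 1) ^ j : ℤ_[p][X]) : PowerSeries ℤ_[p]) := by
  ext n
  rw [PowerSeries.coeff_mk, Polynomial.coeff_coe, Polynomial.coeff_coe, finsetSum_coeff, finsetSum_coeff, map_sum,
    Finsupp.coe_finsetSum, Finset.sum_apply]
  refine Finset.sum_congr rfl fun j _ ↦ ?_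
  rw [coeff_C_mul, coeff_C_mul, coeff_X_add_one_pow, coeff_X_add_one_pow, mul_comm, ← nsmul_eq_mul, map_nsmul,
    Finsupp.smul_apply, nsmul_eq_mul, mul_comm]

omit [Algebra ℤ_[p] O] in
/-- `↑((C m · Q).map f) = m · ↑(Q.map f)` in `R⟦T⟧` for an integer `m` and `Q ∈ ℤ[T]`. [folklore] -/
theorem coe_map_C_mul_eq_intCast_mul {R : Type*} [CommRing R] (f : ℤ →+* R) (m : ℤ) (Q : ℤ[X]) :
    (((Polynomial.C m * Q).map f : R[X]) : PowerSeries R) = (m : PowerSeries R) * ((Q.map f : R[X]) : PowerSeries R) := by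
  rw [Polynomial.map_mul, Polynomial.map_C, eq_intCast, Polynomial.coe_mul, Polynomial.coe_C, map_intCast]

/-- Reconstruction: `L = 0` as soon as every coordinate series vanishes (`𝒪` finite free with the finite basis `b`). [folklore] -/
theorem eq_zero_of_forall_coordSeries_eq_zero [Fintype ι'] {L : PowerSeries O}
    (h : ∀ i, (PowerSeries.mk fun k ↦ b.repr (PowerSeries.coeff k L) i) = 0) : L = 0 := by
  ext n
  rw [map_zero, ← b.forall_coord_eq_zero_iff]
  intro i
  have := congrArg (PowerSeries.coeff n) (h i)
  rwa [PowerSeries.coeff_mk, map_zero] at this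

end Coord

/-! ## §2 Killing every `E⁺(K_n·K_v)` forces the plus value to vanish (any prime, any data, no generation clause) -/

section Forward

variable {K : Type u} [Field K] {p : ℕ} [hp : Fact p.Prime] {κ : ZpExtension K p}
variable {E : Type u} [Field E] [Algebra K E] {ι : AlgebraicClosure K →ₐ[K] AlgebraicClosure E} {W : WeierstrassCurve K}
variable {O : Type*} [CommRing O] [Algebra ℤ_[p] O] [Module.Free ℤ_[p] O] [Module.Finite ℤ_[p] O]

/-- **`z|_{E⁺_∞} = 0 ⇒ Col⁺_𝒪(z) = 0`.** Let `d` be an (L)(TR)-family (`d_m ∈ E(K_m·K_v)`, `Tr_{m+2/m+1} d_{m+2} = −d_m`), `g` with all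
`gʲ·d_m` in the tower, `z : E(K_∞·K_v) → 𝒪` additive (`𝒪` finite free over `ℤ_p`) and `L ∈ 𝒪⟦T⟧` with the even-level congruences
`ω_{2m} ∣ Σ_{j<p^{2m}} C(z(gʲ·d_{2m}))(X+1)^j + (−1)^m·ω⁻_{2m}·L` (Sprung's sign). If `z` vanishes on `signedLocalPointsOfEmb κ ι W 1 n` for
every `n`, then `L = 0`: in coordinates, `ω_{2k} ∣ (−1)^k ω⁻_{2k}·L⁽ⁱ⁾` (the orbit sums vanish as `gʲ·d_{2k} ∈ E⁺(K_{2k}·K_v)`), and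
`((−1)^k ω⁻_{2k})(ζ−1) = v_{2k}(ζ−1) ≠ 0` at every `ζ` of exact order `p^{2k}`, so `L⁽ⁱ⁾` has infinitely many zeros in the open disc.
[cite: Kobayashi2003, Thm. 6.2, Prop. 8.12 i), Prop. 8.18–8.23] [cite: Sprung2012, Def. 5.9, Def. 7.9] [cite: Sprung2017, Cor. 4.4] -/
theorem eq_zero_of_plusCongr_of_forall_signedPlus {g : Field.absoluteGaloisGroup E} {d : ℕ → localPoints W E}
    (hd : ∀ m, d m ∈ localLayerPointsOfEmb κ ι W m)
    (htr : ∀ m, localTraceOfEmb κ ι W (m + 1) (m + 2) (d (m + 2)) = -d m)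
    (hdA : ∀ m j, g ^ j • d m ∈ Sprung2012.localTowerPointsOfEmb κ ι W)
    (z : Sprung2012.localTowerPointsOfEmb κ ι W →+ O) (L : PowerSeries O)
    (hcong : ∀ m : ℕ, (((cyclotomicOmega p (2 * m)).map (Int.castRingHom O) : O[X]) : PowerSeries O) ∣
      ((∑ j ∈ range (p ^ (2 * m)), C (z ⟨g ^ j • d (2 * m), hdA (2 * m) j⟩) * (X + 1) ^ j : O[X]) : PowerSeries O) +
        (-1 : PowerSeries O) ^ m * (((cyclotomicOmegaMinus p (2 * m)).map (Int.castRingHom O) : O[X]) : PowerSeries O) * L)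
    (hz : ∀ (n : ℕ) (x : localPoints W E) (hx : x ∈ signedLocalPointsOfEmb κ ι W 1 n),
      z ⟨x, Sprung2012.localLayerPointsOfEmb_le_localTowerPointsOfEmb κ ι W n (signedLocalPointsOfEmb_le κ ι W 1 n hx)⟩ = 0) :
    L = 0 := by
  set b := Module.Free.chooseBasis ℤ_[p] O with hb
  haveI : Fintype (Module.Free.ChooseBasisIndex ℤ_[p] O) := Module.Free.ChooseBasisIndex.fintype ℤ_[p] O
  refine eq_zero_of_forall_coordSeries_eq_zero b fun i ↦ ?_
  refine SignedKatoOffTwo.ColemanConverse.eq_zero_of_forall_even_hasSum_zero fun k hk ζ hζ ↦ ?_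
  -- the orbit sums of `z` at level `2k` vanish
  have horbit : ∀ j, z ⟨g ^ j • d (2 * k), hdA (2 * k) j⟩ = 0 := fun j ↦ by
    have hmem : g ^ j • d (2 * k) ∈ signedLocalPointsOfEmb κ ι W 1 (2 * k) :=
      SignedEC.closure_orbit_le_signedLocalPointsOfEmb W κ ι 1 (2 * k) (SignedEC.d_even_mem_signedLocalPointsOfEmb_one W κ ι d hd htr k)
        (AddSubgroup.subset_closure ⟨g ^ j, rfl⟩)
    exact hz (2 * k) _ hmem
  -- the congruence at level `2k`, with the sign written as the integer polynomial factor `C((−1)^k)`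
  have hck : (((cyclotomicOmega p (2 * k)).map (Int.castRingHom O) : O[X]) : PowerSeries O) ∣
      ((∑ j ∈ range (p ^ (2 * k)), C (z ⟨g ^ j • d (2 * k), hdA (2 * k) j⟩) * (X + 1) ^ j : O[X]) : PowerSeries O) +
        (((Polynomial.C ((-1 : ℤ) ^ k) * cyclotomicOmegaMinus p (2 * k)).map (Int.castRingHom O) : O[X]) : PowerSeries O) * L := by
    have h := hcong k
    rwa [show (-1 : PowerSeries O) ^ k * (((cyclotomicOmegaMinus p (2 * k)).map (Int.castRingHom O) : O[X]) : PowerSeries O) * L =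
      (((Polynomial.C ((-1 : ℤ) ^ k) * cyclotomicOmegaMinus p (2 * k)).map (Int.castRingHom O) : O[X]) : PowerSeries O) * L by
        rw [coe_map_C_mul_eq_intCast_mul]; push_cast; ring] at h
  -- … in coordinates: `ω_{2k} ∣ v_{2k} · L⁽ⁱ⁾`
  have hdiv : toIwasawa p (cyclotomicOmega p (2 * k)) ∣
      toIwasawa p (flatPoly 0 p (2 * k)) * PowerSeries.mk fun n ↦ b.repr (PowerSeries.coeff n L) i := by
    have h := intPoly_dvd_coordSeries_of_dvd b i (cyclotomicOmega p (2 * k)) hck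
    rw [coordSeries_add, coordSeries_orbitSum, coordSeries_intPoly_mul] at h
    simp only [horbit, map_zero, Finsupp.zero_apply, map_zero, zero_mul, Finset.sum_const_zero, Polynomial.coe_zero,
      zero_add] at h
    rw [flatPoly_zero_of_even p (even_two_mul k), show 2 * k / 2 = k by omega, toIwasawa_apply, toIwasawa_apply,
      ← Polynomial.C_1, ← Polynomial.C_neg, ← Polynomial.C_pow]
    exact h
  exact SignedKatoOffTwo.ColemanConverse.hasSum_coeff_zero_of_cyclotomicOmega_dvd_toIwasawa_mul hdiv hζ.pow_eq_one
    (SignedKatoOffTwo.ColemanConverse.eval₂_flatPoly_zero_two_mul_ne_zero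
      (SignedKatoOffTwo.ColemanConverse.eval_cyclotomic_odd_pow_ne_zero_of_isPrimitiveRoot_even hζ) k)

end Forward

/-! ## §3 Conversely: plus value `0` forces vanishing on every `E⁺(K_n·K_v)` (granted the generation clauses of the Honda system) -/

section Backward

variable {K : Type u} [Field K] {p : ℕ} [hp : Fact p.Prime] {κ : ZpExtension K p}
variable {E : Type u} [Field E] [Algebra K E] {ι : AlgebraicClosure K →ₐ[K] AlgebraicClosure E} {W : WeierstrassCurve K}
variable {O : Type*} [CommRing O] [Algebra ℤ_[p] O] [Module.Free ℤ_[p] O] [Module.Finite ℤ_[p] O]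

omit [Module.Finite ℤ_[p] O] in
/-- **`Col⁺_𝒪(z) = 0 ⇒ z|_{E⁺_∞} = 0`** (hypothesis-shaped in the generation clauses): for a (L)(TR)-family `d` with Kobayashi's generation
clauses (GEN) `E(K_m·K_v) = ⟨Γ·d_m⟩ + E(K_{m−1}·K_v) + p·E(K_m·K_v)` (`m ≥ 1`), (GEN₀) `E(K_v) = ℤd_0 + p·E(K_v)`, no `p`-torsion in the tower,
layer indices `p`, and a local lift `g` of the topological generator: if the orbit polynomials of an `𝒪`-valued functional `z` (`𝒪` finite free
over `ℤ_p`) satisfy `ω_{2m} ∣ Σ_{j<p^{2m}} C(z(gʲ·d_{2m}))(X+1)^j` for all `m` (plus value `0`), then `z` vanishes on every `E⁺(K_n·K_v)`: each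
coordinate `z⁽ⁱ⁾` lies in `Ker Col♭` (its ♭-value has infinitely many zeros), and TP2's `Ker Col♭ ⊆ ann(E⁺)` applies coordinatewise.
[cite: Kobayashi2003, Thm. 6.2, Prop. 8.12, Prop. 8.18–8.23] [cite: Sprung2012, Thm. 2.2 (2′), Def. 7.9] [cite: Sprung2017, Cor. 4.4] -/
theorem forall_signedPlus_eq_zero_of_plusCongr_zero
    (hnt : ∀ P ∈ Sprung2012.localTowerPointsOfEmb κ ι W, p • P = 0 → P = 0)
    (hidx : ∀ m : ℕ, ((localLayerSubgroupOfEmb κ ι (m + 1)).subgroupOf (localLayerSubgroupOfEmb κ ι m)).index = p)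
    {g : Field.absoluteGaloisGroup E} (hg : κ.IsTopGenerator (resGalOfEmb ι g)) {d : ℕ → localPoints W E}
    (hd : ∀ m, d m ∈ localLayerPointsOfEmb κ ι W m)
    (htr : ∀ m, localTraceOfEmb κ ι W (m + 1) (m + 2) (d (m + 2)) = -d m)
    (hgen : ∀ m : ℕ, 1 ≤ m → ∀ P ∈ localLayerPointsOfEmb κ ι W m,
      ∃ B ∈ AddSubgroup.closure (Set.range fun σ : Field.absoluteGaloisGroup E ↦ σ • d m),
        ∃ P' ∈ localLayerPointsOfEmb κ ι W (m - 1), ∃ R ∈ localLayerPointsOfEmb κ ι W m, P = B + P' + p • R)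
    (hgen0 : ∀ P ∈ localLayerPointsOfEmb κ ι W 0, ∃ a : ℤ, ∃ R ∈ localLayerPointsOfEmb κ ι W 0, P = a • d 0 + p • R)
    (hdA : ∀ m j, g ^ j • d m ∈ Sprung2012.localTowerPointsOfEmb κ ι W)
    (z : Sprung2012.localTowerPointsOfEmb κ ι W →+ O)
    (hcong : ∀ m : ℕ, (((cyclotomicOmega p (2 * m)).map (Int.castRingHom O) : O[X]) : PowerSeries O) ∣
      ((∑ j ∈ range (p ^ (2 * m)), C (z ⟨g ^ j • d (2 * m), hdA (2 * m) j⟩) * (X + 1) ^ j : O[X]) : PowerSeries O))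
    (n : ℕ) (x : localPoints W E) (hx : x ∈ signedLocalPointsOfEmb κ ι W 1 n) :
    z ⟨x, Sprung2012.localLayerPointsOfEmb_le_localTowerPointsOfEmb κ ι W n (signedLocalPointsOfEmb_le κ ι W 1 n hx)⟩ = 0 := by
  set b := Module.Free.chooseBasis ℤ_[p] O with hb
  rw [← b.forall_coord_eq_zero_iff]
  intro i
  -- the coordinate functional `z⁽ⁱ⁾`
  set zi : Sprung2012.localTowerPointsOfEmb κ ι W →+ ℤ_[p] := (b.coord i).toAddMonoidHom.comp z with hzi
  have hzi_apply : ∀ y, zi y = b.repr (z y) i := fun y ↦ rfl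
  -- `z⁽ⁱ⁾ ∈ Ker Col♭`
  obtain ⟨Ls, Lf, hpair⟩ := exists_isColemanPair_apZero κ ι W hg d hd htr zi
  have hLf : Lf = 0 := by
    refine SignedKatoOffTwo.ColemanConverse.eq_zero_of_forall_even_hasSum_zero fun k hk ζ hζ ↦ ?_
    -- Sprung's congruence at level `2k` for `z⁽ⁱ⁾`: `ω ∣ P_{2k}(z⁽ⁱ⁾) + v_{2k} Lf`
    have h1 := hpair (2 * k)
    rw [sharpPoly_zero_of_even p (even_two_mul k), map_zero, zero_mul, zero_add, pairingSum_eq_coe_orbitSum] at h1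
    rw [Finset.sum_congr rfl fun j _ ↦ by rw [Sprung2012.evalOn_of_mem W _ zi (hdA (2 * k) j)]] at h1
    -- the hypothesis at level `2k` in the `i`-th coordinate: `ω ∣ P_{2k}(z⁽ⁱ⁾)`
    have h2 := intPoly_dvd_coordSeries_of_dvd b i (cyclotomicOmega p (2 * k)) (hcong k)
    rw [coordSeries_orbitSum] at h2
    simp only [← hzi_apply] at h2
    -- subtract
    have h3 : toIwasawa p (cyclotomicOmega p (2 * k)) ∣ toIwasawa p (flatPoly 0 p (2 * k)) * Lf := by
      have := dvd_sub h1 h2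
      rwa [toIwasawa_apply, add_sub_cancel_left] at this
    exact SignedKatoOffTwo.ColemanConverse.hasSum_coeff_zero_of_cyclotomicOmega_dvd_toIwasawa_mul h3 hζ.pow_eq_one
      (SignedKatoOffTwo.ColemanConverse.eval₂_flatPoly_zero_two_mul_ne_zero
        (SignedKatoOffTwo.ColemanConverse.eval_cyclotomic_odd_pow_ne_zero_of_isPrimitiveRoot_even hζ) k)
  have hmem : zi ∈ Sprung2012.colemanKer κ ι W 0 g d .flat := by
    rw [Sprung2012.mem_colemanKer_iff]
    exact ⟨Ls, Lf, hpair, hLf⟩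
  exact SignedKatoOffTwo.LocalTwo.colemanKer_flat_apply_eq_zero_of_mem_signedLocalPointsOfEmb_one_of_honda hnt hidx hg hd htr hgen
    hgen0 hmem n x hx

end Backward

/-! ## §4 `p = 2`, the cyclotomic tower at `v ∋ 2`: ONE plus Honda family for which `Col⁺ ⊗ 𝒪` exists, is onto `Λ_𝒪`, and has kernel `ann(E⁺_∞)` -/

section Two

open NumberField IsDedekindDomain WeierstrassCurve Literature.NumberTheory.EllipticCurves.Rank1Residual

variable (W : WeierstrassCurve ℚ) [W.IsElliptic] [W.IsGloballyMinimal]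

/-- **`Col⁺ ⊗ 𝒪` at `p = 2` in the functional model — existence, surjectivity and KERNEL for one plus Honda family.** For `W/ℚ` globally minimal
with `GoodSS W 2`, `a₂(W) = 0`, the cyclotomic `κ` and `v ∋ 2` there are a local lift `g` of the topological generator and a family `d` with
(L) `d_m ∈ E(ℚ_{m,v})`, (TR) `Tr_{m+2/m+1} d_{m+2} = −d_m`, (ND) `d_0 ∉ 2E(ℚ_v)` (and HONDA⁺@2's (GEN), (GEN₀), tree `plusHondaSystemTwo_adicCompletion`)
such that for EVERY `𝒪` finite free over `ℤ₂` and a domain (e.g. `padicCoeffIntegers S`): (i) every `𝒪`-valued functional `z` on `E(ℚ_{2,∞}·ℚ_v)`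
has a plus value `L ∈ 𝒪⟦T⟧` (`ω_{2m} ∣ Σ_{j<4^m} C(z(gʲ·d_{2m}))(X+1)^j + (−1)^m ω⁻_{2m}·L` for all `m`); (ii) every `F ∈ 𝒪⟦T⟧` is such a value;
(iii) a plus value of `z` is `0` IFF `z` vanishes on every `E⁺(ℚ_{2,n}·ℚ_v) = signedLocalPoints κ ℚ_v W 1 n`. With (i)–(iii):
`Col⁺ ⊗ 𝒪 : Hom(E(ℚ_{2,∞}·ℚ_v), 𝒪)/ann(E⁺_∞) ≅ Λ_𝒪` — Kobayashi's Thm. 6.2 with coefficients at the prime `2`, the local input of `stub_plusColemanO`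
(STUB-PLAN rev 4 §3.2) up to the `col₀`-glue with `H¹_Iw`. [cite: Kobayashi2003, Thm. 6.2 (6.13), Prop. 8.12, Prop. 8.18–8.23]
[cite: Sprung2012, Thm. 2.2 (2′), Prop. 7.3, Def. 5.9, Def. 7.9] [cite: Sprung2017, Cor. 4.4] -/
theorem colemanPlus_coeff_two (hss : GoodSS W 2) (ha : W.frobeniusTrace 2 = 0) (κ : ZpExtension ℚ 2) (hκ : κ.IsCyclotomic)
    (v : HeightOneSpectrum (𝓞 ℚ)) (hv : (2 : 𝓞 ℚ) ∈ v.asIdeal) :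
    ∃ (g : Field.absoluteGaloisGroup (v.adicCompletion ℚ)) (d : ℕ → localPoints W (v.adicCompletion ℚ))
      (hdA : ∀ m j, g ^ j • d m ∈ Sprung2012.localTowerPointsOfEmb κ (closureEmb (K := ℚ) (v.adicCompletion ℚ)) W),
      κ.IsTopGenerator (resGalOfEmb (closureEmb (K := ℚ) (v.adicCompletion ℚ)) g) ∧
      (∀ m, d m ∈ localLayerPointsOfEmb κ (closureEmb (K := ℚ) (v.adicCompletion ℚ)) W m) ∧
      (∀ m, localTraceOfEmb κ (closureEmb (K := ℚ) (v.adicCompletion ℚ)) W (m + 1) (m + 2) (d (m + 2)) = -d m) ∧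
      (∀ b ∈ localLayerPointsOfEmb κ (closureEmb (K := ℚ) (v.adicCompletion ℚ)) W 0, d 0 ≠ 2 • b) ∧
      ∀ (O : Type) [CommRing O] [IsDomain O] [Algebra ℤ_[2] O] [Module.Free ℤ_[2] O] [Module.Finite ℤ_[2] O],
        (∀ z : Sprung2012.localTowerPointsOfEmb κ (closureEmb (K := ℚ) (v.adicCompletion ℚ)) W →+ O, ∃ L : PowerSeries O, ∀ m : ℕ,
          (((cyclotomicOmega 2 (2 * m)).map (Int.castRingHom O) : O[X]) : PowerSeries O) ∣
            ((∑ j ∈ range (2 ^ (2 * m)), C (z ⟨g ^ j • d (2 * m), hdA (2 * m) j⟩) * (X + 1) ^ j : O[X]) : PowerSeries O) +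
              (-1 : PowerSeries O) ^ m * (((cyclotomicOmegaMinus 2 (2 * m)).map (Int.castRingHom O) : O[X]) : PowerSeries O) * L) ∧
        (∀ F : PowerSeries O, ∃ z : Sprung2012.localTowerPointsOfEmb κ (closureEmb (K := ℚ) (v.adicCompletion ℚ)) W →+ O, ∀ m : ℕ,
          (((cyclotomicOmega 2 (2 * m)).map (Int.castRingHom O) : O[X]) : PowerSeries O) ∣
            ((∑ j ∈ range (2 ^ (2 * m)), C (z ⟨g ^ j • d (2 * m), hdA (2 * m) j⟩) * (X + 1) ^ j : O[X]) : PowerSeries O) +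
              (-1 : PowerSeries O) ^ m * (((cyclotomicOmegaMinus 2 (2 * m)).map (Int.castRingHom O) : O[X]) : PowerSeries O) * F) ∧
        (∀ (z : Sprung2012.localTowerPointsOfEmb κ (closureEmb (K := ℚ) (v.adicCompletion ℚ)) W →+ O) (L : PowerSeries O),
          (∀ m : ℕ, (((cyclotomicOmega 2 (2 * m)).map (Int.castRingHom O) : O[X]) : PowerSeries O) ∣
            ((∑ j ∈ range (2 ^ (2 * m)), C (z ⟨g ^ j • d (2 * m), hdA (2 * m) j⟩) * (X + 1) ^ j : O[X]) : PowerSeries O) +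
              (-1 : PowerSeries O) ^ m * (((cyclotomicOmegaMinus 2 (2 * m)).map (Int.castRingHom O) : O[X]) : PowerSeries O) * L) →
          (L = 0 ↔ ∀ (n : ℕ) (x : localPoints W (v.adicCompletion ℚ))
            (hx : x ∈ signedLocalPoints κ (v.adicCompletion ℚ) W 1 n),
            z ⟨x, Sprung2012.localLayerPointsOfEmb_le_localTowerPointsOfEmb κ _ W n (signedLocalPointsOfEmb_le κ _ W 1 n hx)⟩ = 0)) := by
  set ι := closureEmb (K := ℚ) (v.adicCompletion ℚ) with hι
  obtain ⟨g, hg⟩ := ZpExtension.IsCyclotomic.exists_isTopGenerator_resGalOfEmb_adicCompletion hκ v hv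
  obtain ⟨d, hd, htr, hgen, hgen0⟩ := SignedEC.PlusLayer.plusHondaSystemTwo_adicCompletion W hss ha κ hκ v hv
  -- (ND) from (GEN₀) and LEV0@2
  have hND : ∀ b ∈ localLayerPointsOfEmb κ ι W 0, d 0 ≠ 2 • b := by
    obtain ⟨m₀, hm₀, hne⟩ := SignedEC.exists_mem_localLayerPointsOfEmb_zero_ne_two_nsmul W κ v hv
    intro b hb hdb
    obtain ⟨c, R, hR, hm₀eq⟩ := hgen0 m₀ hm₀
    refine hne (c • b + R) (AddSubgroup.add_mem _ (AddSubgroup.zsmul_mem _ hb c) hR) ?_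
    rw [hm₀eq, hdb, smul_add, smul_comm]
  have hdA : ∀ m j, g ^ j • d m ∈ Sprung2012.localTowerPointsOfEmb κ ι W := fun m j ↦
    Sprung2012.smul_mem_localTowerPointsOfEmb κ ι W _ (Sprung2012.localLayerPointsOfEmb_le_localTowerPointsOfEmb κ ι W m (hd m))
  have hnt : ∀ P ∈ Sprung2012.localTowerPointsOfEmb κ ι W, 2 • P = 0 → P = 0 := fun P hP h2 ↦
    SSFlatEC.eq_zero_of_mem_localTowerPointsOfEmb_of_two_nsmul W hss κ hv _ hP h2
  have hidx : ∀ m : ℕ, ((localLayerSubgroupOfEmb κ ι (m + 1)).subgroupOf (localLayerSubgroupOfEmb κ ι m)).index = 2 :=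
    SignedEC.index_subgroupOf_localLayerSubgroupOfEmb_succ_eq hκ v hv
  refine ⟨g, d, hdA, hg, hd, htr, hND, fun O _ _ _ _ _ ↦ ⟨fun z ↦ ?_, fun F ↦ ?_, fun z L hcong ↦ ⟨fun hL ↦ ?_, fun hz ↦ ?_⟩⟩⟩
  · -- (i) existence: `…PairingSumPlusValueCoeff.exists_plusValue_addMonoidHom_coeff` (sign flipped)
    have hfix : ∀ n, g ^ 2 ^ n • d n = d n := fun n ↦ by
      simpa using Sprung2012.pow_mul_smul_of_mem_localLayerPointsOfEmb κ ι W hg (hd n) 1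
    have htr' : ∀ n, ∑ s ∈ range 2, g ^ (2 ^ (n + 1) * s) • d (n + 2) = -d n := fun n ↦ by
      rw [← Sprung2012.localTraceOfEmb_succ_eq_sum_pow_smul κ ι W hg (n + 1) (hd (n + 2))]
      exact htr n
    obtain ⟨L, hL⟩ := exists_plusValue_addMonoidHom_coeff W (Sprung2012.localTowerPointsOfEmb κ ι W) g d hdA hfix htr' z
    refine ⟨-L, fun m ↦ ?_⟩
    have h := hL m
    convert h using 2
    ring
  · -- (ii) onto: a unit functional at `d_0`, then `exists_isColemanPair_flat_eq_of_isUnit`, coordinatewise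
    obtain ⟨z₀, hz₀⟩ := exists_addMonoidHom_isUnit_two W hss κ v hv d hd hND
    have honto' : ∀ a : PowerSeries ℤ_[2], ∃ z : Sprung2012.localTowerPointsOfEmb κ ι W →+ ℤ_[2], ∀ m : ℕ,
        (((cyclotomicOmega 2 (2 * m)).map (Int.castRingHom ℤ_[2]) : ℤ_[2][X]) : PowerSeries ℤ_[2]) ∣
          ((∑ j ∈ range (2 ^ (2 * m)), C (z ⟨g ^ j • d (2 * m), hdA (2 * m) j⟩) * (X + 1) ^ j : ℤ_[2][X]) : PowerSeries ℤ_[2]) +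
            (((-1 : ℤ) ^ m : ℤ) : PowerSeries ℤ_[2]) *
              (((cyclotomicOmegaMinus 2 (2 * m)).map (Int.castRingHom ℤ_[2]) : ℤ_[2][X]) : PowerSeries ℤ_[2]) * a := by
      intro a
      obtain ⟨z, Ls, hz⟩ := exists_isColemanPair_flat_eq_of_isUnit κ ι W hg d hd htr z₀ hz₀ a
      refine ⟨z, fun m ↦ ?_⟩
      have h := hz (2 * m)
      rw [sharpPoly_zero_of_even 2 (even_two_mul m), flatPoly_zero_of_even 2 (even_two_mul m),
        show 2 * m / 2 = m by omega, map_zero, zero_mul, zero_add, toIwasawa_apply, toIwasawa_apply,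
        pairingSum_eq_coe_orbitSum, Polynomial.map_mul, Polynomial.map_pow, Polynomial.map_neg, Polynomial.map_one,
        Polynomial.coe_mul, Polynomial.coe_pow, Polynomial.coe_neg, Polynomial.coe_one] at h
      rw [Finset.sum_congr rfl fun j _ ↦ by rw [Sprung2012.evalOn_of_mem W _ z (hdA (2 * m) j)]] at h
      convert h using 2
      push_cast
      ring
    obtain ⟨z, hz⟩ := exists_addMonoidHom_coeff_of_forall_exists (O := O)
      (fun m j ↦ (⟨g ^ j • d (2 * m), hdA (2 * m) j⟩ : Sprung2012.localTowerPointsOfEmb κ ι W)) (fun m ↦ 2 ^ (2 * m))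
      (fun m ↦ cyclotomicOmega 2 (2 * m)) (fun m ↦ cyclotomicOmegaMinus 2 (2 * m)) (fun m ↦ (-1) ^ m) honto' F
    refine ⟨z, fun m ↦ ?_⟩
    have h := hz m
    push_cast at h
    exact h
  · -- (iii, ⇒) value `0` ⇒ kills `E⁺`
    subst hL
    intro n x hx
    refine forall_signedPlus_eq_zero_of_plusCongr_zero hnt hidx hg hd htr hgen hgen0 hdA z (fun m ↦ ?_) n x hx
    simpa using hcong m
  · -- (iii, ⇐) kills `E⁺` ⇒ value `0`
    exact eq_zero_of_plusCongr_of_forall_signedPlus hd htr hdA z L hcong hz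

end Two

end Summit.BirchSwinnertonDyer.BirchSwinnertonDyer.Theorems.SignedColemanImage

end
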